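import Literature.Combinatorics.Optimization.EdmondsMatchingPolytope
import Literature.Barriers.PneNP.TSPExtensionComplexityFaces
import HarnessLib

/-!
# The matching polytope admits a polynomial-size LP relaxation scheme
# (the folklore `ρ`-approximation by small odd sets; Braun–Pokutta 2014, Example 2.6)

[topic Combinatorics/Optimization]

G. Braun, S. Pokutta, *The matching polytope does not admit fully-polynomial size relaxation
schemes*, Proc. SODA 2015, 837–846 = arXiv:1403.6710 [BraunPokutta2014] (held text
`paper:arxiv-1403.6710`; locators = chunks `pNNNN Lk` of the lit-read materialisation), §2.2.2,
**Example 2.6 (PSRS for matching)** (p0008 L12–47), verbatim: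

> "The matching problem has the following folklore PSRS: […] We claim that the standard realization
> with the following linear program is an LP formulation of size `O(n^{1/(1−ρ)})` for the matching
> problem with approximation factor `ρ`, for `0 < ρ < 1`.
> `x(δ(v)) ≤ 1 ∀ v ∈ [n]`, `x(E[U]) ≤ (|U| − 1)/(2ρ) ∀ U ⊆ [n], |U| odd, |U| < 1/(1 − ρ)`, `x ≥ 0`.
> Let `K_n` be the polytope defined by these inequalities. For the claim, it is enough to prove
> `P_M ⊆ K_n ⊆ ρ⁻¹ P_M`. The first inequality is obvious, and for the second one, we need to prove
> that for every `x ∈ K_n` we have `x(E[U]) ≤ (|U| − 1)/(2ρ)` for `U ⊆ [n]` odd and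
> `|U| ≥ 1/(1 − ρ)`. This inequality follows by summing up the inequalities `x(δ(v)) ≤ 1` for
> `v ∈ U` and using `x ≥ 0`: `x(E[U]) ≤ ½ Σ_{v ∈ U} x(δ(v)) ≤ |U|/2 ≤ (|U| − 1)/(2ρ)`."

The same construction is the upper-bound remark of T. Rothvoß, *The matching polytope has
exponential extension complexity*, J. ACM 64 (2017) = arXiv:1311.2369 [Rothvoss2017], §4
(PDF p. 13, held `paper:arxiv-1311.2369` p0013 L28–32): "suppose […] we would take the odd cut
inequalities only for `|U| ≤ Θ(1/ε)`, then we would obtain a polytope `K` with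
`P_M ⊆ K ⊆ (1 + ε) P_M` which has only `n^{Θ(1/ε)}` many facets" — a `(1+ε)`-approximation in the
sense `P_M ⊆ K ⊆ (1 + ε) P_M` of the MONOTONE matching polytope (loc. cit. L5–8).

This file PROVES the example (no named facts), for an ARBITRARY finite simple graph `G` (the
source states it for `K_n`; the proof is verbatim the same), in the currency of the tree: the
matching polytope is Edmonds' polyhedron `StephenTuncel1999.edmondsPolytope G`
(`= conv(matching vectors)`, `StephenTuncel1999.edmondsPolytope_eq_convexHull`, Edmonds' theorem,
PROVED in `EdmondsMatchingPolytope.lean`), coordinates `G.edgeSet → ℝ`, `E[U] = edgesIn G U`, and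
"LP formulation of size `r`" = `Literature.Barriers.PneNP.HasEFOfSize K r` (a slack-form system with
`r` sign-constrained variables projecting onto `K`, as in `TSPExtensionComplexity.lean`):

* `hasEFOfSize_of_inequalities` — a polyhedron `{x | c_a · x ≤ d_a (a ∈ A)}` given by `|A|`
  inequalities has an EF of size `|A|` (one slack variable per inequality; the generic constructor,
  recorded here because the tree only had the slack-form version `hasEFOfSize_of_system`);
* `relaxedEdmondsPolytope G ρ` — the polytope `K` of Example 2.6 (written `K_ρ(G)` below);
* `edmondsPolytope_subset_relaxed` (`P_M(G) ⊆ K_ρ(G)`, `0 < ρ ≤ 1`), `sum_edgesIn_le_half_card`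
  (`x(E[U]) ≤ |U|/2` from `x ≥ 0` and the degree constraints — the displayed chain),
  `smul_mem_edmondsPolytope_of_mem_relaxed` (`x ∈ K_ρ ⇒ ρx ∈ P_M`), `relaxed_subset_smul_edmondsPolytope`
  (`K_ρ ⊆ ρ⁻¹ P_M`, `0 < ρ < 1`);
* `hasEFOfSize_relaxedEdmondsPolytope` — `K_ρ(G)` has an EF of size
  `|E(G)| + |V(G)| + #{U ⊆ V : |U| odd, |U| < 1/(1 − ρ)}`;
* `exists_approximation_edmondsPolytope` — Rothvoß's phrasing: for every `ε > 0` a polytope `K`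
  with `P_M ⊆ K ⊆ (1 + ε) P_M` and an EF of size `|E| + |V| + #{U : |U| odd, |U| < 1 + 1/ε}`;
  `exists_approximation_edmondsPolytope_nat` — the integer instance `ρ = k/(k+1)` (`k ≥ 1`):
  `P_M ⊆ K ⊆ (1 + 1/k) P_M` with an EF of size `≤ |E| + |V| + Σ_{j ≤ k} C(|V|, j)`
  (polynomial in `|V|` for each fixed `k` — a PSRS).

WHAT THIS IS NOT: the matching LOWER bound of the source (Thm. 3.1: every `(1 − ε/n)`-approximate
LP formulation has size `2^{Ω(n)}`; equivalently Rothvoß's Thm. 16 / Cor. 17) is NOT formalised here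
or elsewhere in the tree (its proof is information-theoretic: common information, Pinsker).

## References

* [BraunPokutta2014] G. Braun, S. Pokutta, *The matching polytope does not admit fully-polynomial
  size relaxation schemes*, Proc. 26th SODA (2015) 837–846, doi:10.1137/1.9781611973730.57,
  arXiv:1403.6710 — §2.2.1 (Edmonds' LP, p0007 L100–122), Def. 2.5 and Example 2.6 (p0007 L137 –
  p0008 L47). Journal version: IEEE Trans. Inform. Theory 61 (2015), doi:10.1109/tit.2015.2465864.
* [Rothvoss2017] T. Rothvoß, *The matching polytope has exponential extension complexity*, J. ACM 64
  (2017), arXiv:1311.2369 — §4 (PDF p. 13).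
* [Edmonds1965] J. Edmonds, *Maximum matching and a polyhedron with 0,1-vertices*, J. Res. Nat. Bur.
  Standards 69B (1965) 125–130 — the description of `P_M` (tree: `EdmondsMatchingPolytope.lean`).
-/

noncomputable section

open Finset Matrix
open scoped Pointwise

/-! ### A polyhedron given by `|A|` inequalities has an extended formulation of size `|A|` -/

namespace Literature.Barriers.PneNP

/-- **Inequality systems are extended formulations**: `{x | c_a · x ≤ d_a for all a ∈ A}` is the
projection of the slack form `C x + y = d`, `y ≥ 0` with `|A|` sign-constrained variables, hence
`HasEFOfSize {x | ∀ a, c_a · x ≤ d_a} |A|` ("the size of an LP formulation is the number of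
inequalities"). [cite: BraunPokutta2014, §2.2.1 (p0007 L100–122: "This linear program provides an LP formulation")] -/
theorem hasEFOfSize_of_inequalities {ι : Type} [Fintype ι] {A : Type} [Fintype A] [DecidableEq A]
    (c : A → ι → ℝ) (d : A → ℝ) :
    HasEFOfSize {x : ι → ℝ | ∀ a, c a ⬝ᵥ x ≤ d a} (Fintype.card A) := by
  have h := hasEFOfSize_of_system (ι := ι) (Matrix.of fun a i => c a i) (1 : Matrix A A ℝ) d
  convert h using 1
  ext x
  simp only [Set.mem_setOf_eq, Matrix.one_mulVec]
  have hmul : ∀ a, (Matrix.of (fun a i => c a i) *ᵥ x) a = c a ⬝ᵥ x := fun a => rfl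
  constructor
  · intro hx
    refine ⟨fun a => d a - c a ⬝ᵥ x, fun a => sub_nonneg.2 (hx a), funext fun a => ?_⟩
    rw [Pi.add_apply, hmul]
    ring
  · rintro ⟨y, hy, hsys⟩ a
    have ha := congrFun hsys a
    rw [Pi.add_apply, hmul] at ha
    linarith [hy a]

end Literature.Barriers.PneNP

namespace Literature.Combinatorics.Optimization

open Literature.Barriers.PneNP (HasEFOfSize hasEFOfSize_of_inequalities)
open StephenTuncel1999

variable {V : Type} [Fintype V] [DecidableEq V] {G : SimpleGraph V} [DecidableRel G.Adj]

/-! ### The relaxation `K_ρ(G)` of Example 2.6 -/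

variable (G) in
/-- **The relaxed matching polytope `K_ρ(G)`** of Example 2.6: `x ≥ 0`, `x(δ(v)) ≤ 1` (`v ∈ V`), and
the odd-set inequalities RELAXED by the factor `ρ⁻¹` and kept only for the SMALL odd sets,
`x(E[U]) ≤ (|U| − 1)/(2ρ)` for `U ⊆ V`, `|U|` odd, `|U| < 1/(1 − ρ)` (here `(|U| − 1)/2` is written as
the natural number `(|U| − 1)/2`, `|U|` being odd, exactly as in `edmondsPolytope`).
[cite: BraunPokutta2014, Example 2.6 (p0008 L14–30)] -/
def relaxedEdmondsPolytope (ρ : ℝ) : Set (G.edgeSet → ℝ) :=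
  {x | (∀ e, 0 ≤ x e) ∧
    (∀ v : V, ∑ e ∈ univ.filter (fun e : G.edgeSet => v ∈ (e : Sym2 V)), x e ≤ 1) ∧
    ∀ S : Finset V, Odd S.card → (S.card : ℝ) < 1 / (1 - ρ) →
      ∑ e ∈ edgesIn G S, x e ≤ (((S.card - 1) / 2 : ℕ) : ℝ) / ρ}

omit [Fintype V] [DecidableEq V] in
/-- For odd `|S|`, the natural number `(|S| − 1)/2` is the real number `(|S| − 1)/2`. [folklore] -/
private theorem cast_half_pred_of_odd {S : Finset V} (hS : Odd S.card) :
    (((S.card - 1) / 2 : ℕ) : ℝ) = ((S.card : ℝ) - 1) / 2 := by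
  obtain ⟨r, hr⟩ := hS
  rw [hr]
  have h1 : (2 * r + 1 - 1) / 2 = r := by omega
  rw [h1]
  push_cast
  ring

/-- **`P_M(G) ⊆ K_ρ(G)`** for `0 < ρ ≤ 1` ("The first inequality is obvious": the kept odd-set
inequalities are only weakened). [cite: BraunPokutta2014, Example 2.6 (p0008 L32–35)] -/
theorem edmondsPolytope_subset_relaxed {ρ : ℝ} (hρ : 0 < ρ) (hρ1 : ρ ≤ 1) :
    edmondsPolytope G ⊆ relaxedEdmondsPolytope G ρ := by
  rintro x ⟨h0, hdeg, hodd⟩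
  refine ⟨h0, hdeg, fun S hS _ => ?_⟩
  have h := hodd S hS
  have hr : (0 : ℝ) ≤ (((S.card - 1) / 2 : ℕ) : ℝ) := Nat.cast_nonneg _
  calc ∑ e ∈ edgesIn G S, x e ≤ (((S.card - 1) / 2 : ℕ) : ℝ) := h
    _ ≤ (((S.card - 1) / 2 : ℕ) : ℝ) / ρ := by
        rw [le_div_iff₀ hρ]
        nlinarith

/-- **`x(E[U]) ≤ ½ Σ_{v ∈ U} x(δ(v)) ≤ |U|/2`** for `x ≥ 0` with `x(δ(v)) ≤ 1`: each edge inside `U`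
is counted from both endpoints (the tree's `two_mul_inSum_eq`), the other terms are nonnegative.
[cite: BraunPokutta2014, Example 2.6 (p0008 L40–47, the displayed chain)] -/
theorem sum_edgesIn_le_half_card {x : G.edgeSet → ℝ} (h0 : ∀ e, 0 ≤ x e)
    (hdeg : ∀ v : V, ∑ e ∈ univ.filter (fun e : G.edgeSet => v ∈ (e : Sym2 V)), x e ≤ 1)
    (S : Finset V) : ∑ e ∈ edgesIn G S, x e ≤ (S.card : ℝ) / 2 := by
  -- read `x` as the `x₀ = 1` slice `lift1 x` of the cone currency
  have hin : inSum G S (lift1 x) = ∑ e ∈ edgesIn G S, x e := rfl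
  have hl0 : ∀ i, 0 ≤ lift1 x i := by
    rintro (_ | e)
    · show (0 : ℝ) ≤ 1
      norm_num
    · exact h0 e
  have h2 := two_mul_inSum_eq (lift1 x) S
  rw [hin] at h2
  -- `Σ_{w ∈ S} x(vw) ≤ Σ_w x(vw) = x(δ(v)) ≤ 1`
  have hv : ∀ v ∈ S, ∑ w ∈ S, extX G (lift1 x) s(v, w) ≤ 1 := by
    intro v _
    calc ∑ w ∈ S, extX G (lift1 x) s(v, w) ≤ ∑ w, extX G (lift1 x) s(v, w) :=
          Finset.sum_le_univ_sum_of_nonneg fun w => extX_nonneg hl0 _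
      _ = ∑ e ∈ univ.filter (fun e : G.edgeSet => v ∈ (e : Sym2 V)), x e := by
          rw [← deg_eq_sum_extX (lift1 x) v]
          rfl
      _ ≤ 1 := hdeg v
  have hsum : ∑ v ∈ S, ∑ w ∈ S, extX G (lift1 x) s(v, w) ≤ S.card := by
    calc ∑ v ∈ S, ∑ w ∈ S, extX G (lift1 x) s(v, w) ≤ ∑ _v ∈ S, (1 : ℝ) := Finset.sum_le_sum hv
      _ = S.card := by simp
  rw [le_div_iff₀ (by norm_num : (0 : ℝ) < 2)]
  linarith

/-- **`x ∈ K_ρ(G) ⇒ ρ x ∈ P_M(G)`** (`0 < ρ < 1`): nonnegativity and the degree inequalities scale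
(`ρ ≤ 1`); a small odd `U` gets `ρ · x(E[U]) ≤ (|U| − 1)/2` from the relaxed inequality; a large odd
`U` (`|U| ≥ 1/(1 − ρ)`, i.e. `ρ|U| ≤ |U| − 1`) gets it from `x(E[U]) ≤ |U|/2`.
[cite: BraunPokutta2014, Example 2.6 (p0008 L35–47)] -/
theorem smul_mem_edmondsPolytope_of_mem_relaxed {ρ : ℝ} (hρ : 0 < ρ) (hρ1 : ρ < 1)
    {x : G.edgeSet → ℝ} (hx : x ∈ relaxedEdmondsPolytope G ρ) :
    ρ • x ∈ edmondsPolytope G := by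
  obtain ⟨h0, hdeg, hodd⟩ := hx
  have hsm : ∀ e, (ρ • x) e = ρ * x e := fun e => rfl
  refine ⟨fun e => ?_, fun v => ?_, fun S hS => ?_⟩
  · rw [hsm]
    exact mul_nonneg hρ.le (h0 e)
  · simp_rw [hsm, ← Finset.mul_sum]
    have h := hdeg v
    nlinarith
  · simp_rw [hsm, ← Finset.mul_sum]
    rw [cast_half_pred_of_odd hS]
    by_cases hsmall : (S.card : ℝ) < 1 / (1 - ρ)
    · -- kept (relaxed) inequality
      have h := hodd S hS hsmall
      rw [cast_half_pred_of_odd hS, le_div_iff₀ hρ] at h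
      linarith
    · -- large odd set: degree counting
      have hle : 1 / (1 - ρ) ≤ (S.card : ℝ) := not_lt.1 hsmall
      have h1ρ : 0 < 1 - ρ := by linarith
      rw [div_le_iff₀ h1ρ] at hle
      have hhalf := sum_edgesIn_le_half_card h0 hdeg S
      have hρS : ρ * ∑ e ∈ edgesIn G S, x e ≤ ρ * ((S.card : ℝ) / 2) :=
        mul_le_mul_of_nonneg_left hhalf hρ.le
      nlinarith

/-- **`K_ρ(G) ⊆ ρ⁻¹ · P_M(G)`** for `0 < ρ < 1` — together with `edmondsPolytope_subset_relaxed`: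
`P_M ⊆ K_ρ ⊆ ρ⁻¹ P_M`, i.e. `K_ρ(G)` is an LP relaxation of the matching polytope of `G` with
approximation factor `ρ`. [cite: BraunPokutta2014, Example 2.6 (p0008 L30–35)] -/
theorem relaxed_subset_smul_edmondsPolytope {ρ : ℝ} (hρ : 0 < ρ) (hρ1 : ρ < 1) :
    relaxedEdmondsPolytope G ρ ⊆ ρ⁻¹ • edmondsPolytope G := by
  intro x hx
  have h := Set.smul_mem_smul_set (a := ρ⁻¹) (smul_mem_edmondsPolytope_of_mem_relaxed hρ hρ1 hx)
  rwa [inv_smul_smul₀ hρ.ne'] at h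

/-! ### The size of the relaxation -/

variable (V) in
/-- The index set of the kept odd-set inequalities: odd `U ⊆ V` with `|U| < 1/(1 − ρ)`.
[cite: BraunPokutta2014, Example 2.6 (p0008 L24–27)] -/
def smallOddSets (ρ : ℝ) : Finset (Finset V) :=
  univ.filter fun S : Finset V => Odd S.card ∧ (S.card : ℝ) < 1 / (1 - ρ)

omit [DecidableEq V] in
/-- Membership in `smallOddSets`. [cite: BraunPokutta2014, Example 2.6 (p0008 L24–27)] -/
theorem mem_smallOddSets {ρ : ℝ} {S : Finset V} :
    S ∈ smallOddSets V ρ ↔ Odd S.card ∧ (S.card : ℝ) < 1 / (1 - ρ) := by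
  simp [smallOddSets]

omit [DecidableEq V] in
/-- Dot product with a `0/1` indicator vector is the sum over the indicated coordinates. [folklore] -/
private theorem indicator_dotProduct (p : G.edgeSet → Prop) [DecidablePred p] (x : G.edgeSet → ℝ) :
    (fun e => if p e then (1 : ℝ) else 0) ⬝ᵥ x = ∑ e ∈ univ.filter p, x e := by
  rw [dotProduct, Finset.sum_filter]
  exact Finset.sum_congr rfl fun e _ => by split_ifs <;> simp

/-- **`K_ρ(G)` is an LP formulation of size `|E(G)| + |V(G)| + #{U : |U| odd, |U| < 1/(1 − ρ)}`**
(one inequality per nonnegativity, degree and kept odd-set constraint).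
[cite: BraunPokutta2014, Example 2.6 (p0008 L18–30: "an LP formulation of size O(n^{1/(1−ρ)})")] -/
theorem hasEFOfSize_relaxedEdmondsPolytope (ρ : ℝ) :
    HasEFOfSize (relaxedEdmondsPolytope G ρ)
      (Fintype.card G.edgeSet + Fintype.card V + (smallOddSets V ρ).card) := by
  classical
  -- index type of the inequalities
  let A : Type := G.edgeSet ⊕ (V ⊕ (smallOddSets V ρ))
  let c : A → G.edgeSet → ℝ := fun a =>
    Sum.elim (fun e₀ e => if e = e₀ then (-1 : ℝ) else 0)
      (Sum.elim (fun v e => if v ∈ (e : Sym2 V) then (1 : ℝ) else 0)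
        (fun S e => if e ∈ edgesIn G S.1 then (1 : ℝ) else 0)) a
  let d : A → ℝ := fun a =>
    Sum.elim (fun _ => (0 : ℝ)) (Sum.elim (fun _ => (1 : ℝ))
      (fun S => (((S.1.card - 1) / 2 : ℕ) : ℝ) / ρ)) a
  have hEF := hasEFOfSize_of_inequalities (ι := G.edgeSet) c d
  have hcard : Fintype.card A = Fintype.card G.edgeSet + Fintype.card V + (smallOddSets V ρ).card := by
    simp only [A, Fintype.card_sum, Fintype.card_coe, Nat.add_assoc]
  rw [hcard] at hEF
  convert hEF using 1
  ext x
  simp only [relaxedEdmondsPolytope, Set.mem_setOf_eq]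
  -- the three kinds of rows
  have hneg : ∀ e₀ : G.edgeSet, (fun e => if e = e₀ then (-1 : ℝ) else 0) ⬝ᵥ x = -x e₀ := by
    intro e₀
    rw [dotProduct]
    simp only [ite_mul, neg_mul, one_mul, zero_mul, Finset.sum_ite_eq', Finset.mem_univ, if_true]
  have hdegrow : ∀ v : V, (fun e : G.edgeSet => if v ∈ (e : Sym2 V) then (1 : ℝ) else 0) ⬝ᵥ x =
      ∑ e ∈ univ.filter (fun e : G.edgeSet => v ∈ (e : Sym2 V)), x e := fun v =>
    indicator_dotProduct (fun e : G.edgeSet => v ∈ (e : Sym2 V)) x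
  have hoddrow : ∀ S : Finset V, (fun e : G.edgeSet => if e ∈ edgesIn G S then (1 : ℝ) else 0) ⬝ᵥ x =
      ∑ e ∈ edgesIn G S, x e := by
    intro S
    rw [indicator_dotProduct (fun e : G.edgeSet => e ∈ edgesIn G S) x]
    congr 1
    ext e
    simp
  constructor
  · rintro ⟨h0, hdeg, hodd⟩ a
    rcases a with e₀ | v | S
    · show (fun e => if e = e₀ then (-1 : ℝ) else 0) ⬝ᵥ x ≤ 0
      rw [hneg]
      linarith [h0 e₀]
    · show (fun e : G.edgeSet => if v ∈ (e : Sym2 V) then (1 : ℝ) else 0) ⬝ᵥ x ≤ 1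
      rw [hdegrow]
      exact hdeg v
    · show (fun e : G.edgeSet => if e ∈ edgesIn G S.1 then (1 : ℝ) else 0) ⬝ᵥ x ≤
        (((S.1.card - 1) / 2 : ℕ) : ℝ) / ρ
      rw [hoddrow]
      have hS := mem_smallOddSets.1 S.2
      exact hodd S.1 hS.1 hS.2
  · intro h
    refine ⟨fun e₀ => ?_, fun v => ?_, fun S hS hsmall => ?_⟩
    · have h1 := h (Sum.inl e₀)
      change (fun e => if e = e₀ then (-1 : ℝ) else 0) ⬝ᵥ x ≤ 0 at h1
      rw [hneg] at h1
      linarith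
    · have h1 := h (Sum.inr (Sum.inl v))
      change (fun e : G.edgeSet => if v ∈ (e : Sym2 V) then (1 : ℝ) else 0) ⬝ᵥ x ≤ 1 at h1
      rwa [hdegrow] at h1
    · have h1 := h (Sum.inr (Sum.inr ⟨S, mem_smallOddSets.2 ⟨hS, hsmall⟩⟩))
      change (fun e : G.edgeSet => if e ∈ edgesIn G S then (1 : ℝ) else 0) ⬝ᵥ x ≤
        (((S.card - 1) / 2 : ℕ) : ℝ) / ρ at h1
      rwa [hoddrow] at h1

/-! ### Rothvoß's phrasing: `(1 + ε)`-approximations of the monotone polytope `P_M` -/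

/-- **For every `ε > 0` the matching polytope of `G` has a `(1 + ε)`-approximation
`P_M ⊆ K ⊆ (1 + ε) P_M` with an LP formulation of size `|E| + |V| + #{U : |U| odd, |U| < 1 + 1/ε}`**
(Example 2.6 with `ρ = 1/(1 + ε)`, so that `ρ⁻¹ = 1 + ε` and `1/(1 − ρ) = 1 + 1/ε`; Rothvoß: "take the
odd cut inequalities only for `|U| ≤ Θ(1/ε)` […] `n^{Θ(1/ε)}` many facets").
[cite: Rothvoss2017, §4 (PDF p. 13, p0013 L28–32)] [cite: BraunPokutta2014, Example 2.6 (p0008 L14–47)] -/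
theorem exists_approximation_edmondsPolytope {ε : ℝ} (hε : 0 < ε) :
    ∃ K : Set (G.edgeSet → ℝ), edmondsPolytope G ⊆ K ∧ K ⊆ (1 + ε) • edmondsPolytope G ∧
      HasEFOfSize K (Fintype.card G.edgeSet + Fintype.card V +
        (univ.filter fun S : Finset V => Odd S.card ∧ (S.card : ℝ) < 1 + 1 / ε).card) := by
  set ρ : ℝ := 1 / (1 + ε) with hρdef
  have hρ : 0 < ρ := by positivity
  have hρ1 : ρ < 1 := by
    rw [hρdef, div_lt_one (by positivity)]
    linarith
  have hinv : ρ⁻¹ = 1 + ε := by rw [hρdef, one_div, inv_inv]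
  have hthr : 1 / (1 - ρ) = 1 + 1 / ε := by
    have hε0 : ε ≠ 0 := hε.ne'
    have h1 : (1 : ℝ) + ε ≠ 0 := by positivity
    have hsub : 1 - ρ = ε / (1 + ε) := by
      rw [hρdef]
      field_simp
      ring
    rw [hsub, one_div_div, add_div, div_self hε0, add_comm]
  refine ⟨relaxedEdmondsPolytope G ρ, edmondsPolytope_subset_relaxed hρ hρ1.le, ?_, ?_⟩
  · rw [← hinv]
    exact relaxed_subset_smul_edmondsPolytope hρ hρ1
  · have h := hasEFOfSize_relaxedEdmondsPolytope (G := G) ρ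
    have hsets : smallOddSets V ρ = univ.filter fun S : Finset V => Odd S.card ∧ (S.card : ℝ) < 1 + 1 / ε := by
      unfold smallOddSets
      rw [hthr]
    rwa [hsets] at h

/-- Counting the kept odd sets in the integer instance: the odd `U` with `|U| < k + 1` are among the
sets of size `≤ k`, of which there are `Σ_{j ≤ k} C(|V|, j)`. [folklore] -/
private theorem card_smallOdd_le (k : ℕ) :
    (univ.filter fun S : Finset V => Odd S.card ∧ (S.card : ℝ) < (k : ℝ) + 1).card ≤
      ∑ j ∈ Finset.range (k + 1), (Fintype.card V).choose j := by
  classical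
  calc (univ.filter fun S : Finset V => Odd S.card ∧ (S.card : ℝ) < (k : ℝ) + 1).card
      ≤ ((Finset.range (k + 1)).biUnion fun j => (univ : Finset V).powersetCard j).card := by
        refine Finset.card_le_card fun S hS => ?_
        rw [Finset.mem_filter] at hS
        have hlt : S.card < k + 1 := by exact_mod_cast hS.2.2
        rw [Finset.mem_biUnion]
        exact ⟨S.card, Finset.mem_range.2 hlt, Finset.mem_powersetCard.2 ⟨Finset.subset_univ _, rfl⟩⟩
    _ ≤ ∑ j ∈ Finset.range (k + 1), ((univ : Finset V).powersetCard j).card := Finset.card_biUnion_le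
    _ = ∑ j ∈ Finset.range (k + 1), (Fintype.card V).choose j := by
        refine Finset.sum_congr rfl fun j _ => ?_
        rw [Finset.card_powersetCard, Finset.card_univ]

/-- **The integer instance `ρ = k/(k+1)` (a PSRS): for every `k ≥ 1` there is a polytope `K` with
`P_M(G) ⊆ K ⊆ (1 + 1/k) P_M(G)` and an LP formulation of size at most `|E| + |V| + Σ_{j ≤ k} C(|V|, j)`**
— polynomial in `|V|` for each fixed `k` (the kept odd sets are those with `|U| ≤ k`).
[cite: BraunPokutta2014, Def. 2.5 and Example 2.6 (p0007 L137 – p0008 L47)] [cite: Rothvoss2017, §4 (PDF p. 13)] -/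
theorem exists_approximation_edmondsPolytope_nat {k : ℕ} (hk : 1 ≤ k) :
    ∃ (K : Set (G.edgeSet → ℝ)) (r : ℕ), edmondsPolytope G ⊆ K ∧
      K ⊆ (1 + 1 / (k : ℝ)) • edmondsPolytope G ∧ HasEFOfSize K r ∧
      r ≤ Fintype.card G.edgeSet + Fintype.card V + ∑ j ∈ Finset.range (k + 1), (Fintype.card V).choose j := by
  have hkpos : (0 : ℝ) < k := by exact_mod_cast hk
  have hε : (0 : ℝ) < 1 / k := by positivity
  obtain ⟨K, hPK, hKP, hEF⟩ := exists_approximation_edmondsPolytope (G := G) hε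
  refine ⟨K, _, hPK, hKP, hEF, ?_⟩
  have hthr : (1 : ℝ) + 1 / (1 / (k : ℝ)) = (k : ℝ) + 1 := by
    rw [one_div_one_div]
    ring
  rw [hthr]
  have := card_smallOdd_le (V := V) k
  omega

end Literature.Combinatorics.Optimization

end
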